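import Literature.AlgebraicGeometry.AbelianSchemes.RigidifiedAutOfReducedBase
import Literature.AlgebraicGeometry.Modules.EquivariantStructureRestrict
import HarnessLib

/-!
# Rigid descent of a linearisation along the unit section of an abelian scheme over a REDUCED base

Layer `Literature/AlgebraicGeometry/AbelianSchemes`, namespace `Literature.AlgebraicGeometry.AbelianSchemes.AbelianSchemeOver`.
THEOREMS ONLY (no definition, no named fact, no instance).

This is ★ `AbelianVarieties/MumfordSheafLinearisation.exists_equivariantStructure_of_restrictAlong` (Mumford's normalisation of the
`K(L)`-linearisation of `Λ(L)` along `{0} × X`, [MumfordAV1970] §8 pp. 78–80, over a FIELD with `Γ = K`) made RELATIVE: the base is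
an abelian scheme `p : A → T` over a REDUCED locally Noetherian `T` with unit section `ε : T → A`, and the scalars `Kˣ` are
replaced by `Γ(A, 𝒪)ˣ = p^♯ Γ(T, 𝒪)ˣ` (★ `RigidifiedAutOfReducedBase`: `Γ(A, 𝒪)` is read along `ε`, rigidified automorphisms of
line bundles are trivial).

Setting: actions `ρ : ActionOver r G` on the total space `A` (over any `r : A → Y`) and `τ : ActionOver r′ G` on `T`, the unit
section EQUIVARIANT (`hι : τ_g ≫ ε = ε ≫ σ_g`), a line bundle `E` on `A` (`HasRank E 1`); ★ `Modules/EquivariantStructure(Restrict)`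
currency (`EquivariantStructure`, `restrictAlong`, `restrictAlong_pullbackOneIso`, `restrictAlong_mul`).

* §1 `hom_eq_of_restrictAlong_unitSection_eq` — a morphism `σ_g^* E → E` is determined by its restriction along `ε`
  (★ `hom_eq_of_pullback_unitSection_map_eq`); `equivariantStructure_iso_eq_of_restrictAlong_eq` — hence a `G`-linearisation of
  `E` is determined by its restriction along `ε`.
* §2 `restrictAlong_comp_globalScalar_appTop` — rescaling by `p^♯ a` restricts to rescaling by `a`;
  `exists_iso_restrictAlong_eq` — every isomorphism `τ_g^* ε^* E ≅ ε^* E` is the restriction of an isomorphism `σ_g^* E ≅ E`,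
  provided one such exists (rescale by the unit read off on `T`).
* §3 **`exists_equivariantStructure_of_restrictAlong_unitSection`** — RIGID DESCENT: if `σ_g^* E ≅ E` for every `g`, every
  `G`-linearisation `Ψ` of `ε^* E` for `τ` is the restriction along `ε` of a (unique, §1) `G`-linearisation `Φ` of `E` for `ρ`
  (unit and cocycle conditions: both sides are isomorphisms `σ^* E ≅ E` with the same restriction — ★ `restrictAlong_pullbackOneIso`,
  ★ `restrictAlong_mul` — hence equal by §1).

Cell `hodgecm-mathlib` (D-0151), HECKE-LINK H2 file (ii) «dual pair of the quotient `A/K`» (B-p20 (g9) hand D3b 20:47:30Z): with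
`A := (A/K) ×_S Â` over `T := Â`, `ρ :=` the `K′`-translation action on the second factor (B-p06 (g9) D3a), `τ :=` translation on
`Â`, `E := 𝒩₁ = (π × 1)^*𝒫` and `Ψ :=` the trivial linearisation of `ε^*𝒩₁ ≅ 𝒪_Â`, §3 IS the normalised `K′`-equivariant structure
on `𝒩₁` (`hunit`/`hcocycle` of ★ T1 `ActionOver.exists_descent_of_free` = `Φ.iso_one_hom`/`Φ.iso_mul_hom`).  Count-neutral; HC_CM is
proved only modulo the 7 printed citations until rung 0 closes.

## References
* [MumfordAV1970] D. Mumford, *Abelian Varieties* (1970), §8 pp. 78–80 (normalisation along `{0} × X`), §7 Prop. 2, §13 (p. 125).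
* [MumfordFogartyKirwan1994] D. Mumford, J. Fogarty, F. Kirwan, *GIT* 3rd ed. (1994), Ch. 1 §3 Def. 1.6 (p. 30) (`G`-linearisations).
* [MilneAV2008] J. S. Milne, *Abelian Varieties* (v2.00, 2008), I §8 pp. 36–37 and p. 40.
-/

set_option autoImplicit false

noncomputable section

universe u

open CategoryTheory CategoryTheory.Limits AlgebraicGeometry
open Literature.AlgebraicGeometry.RelativeSpec Literature.AlgebraicGeometry.Modules Literature.AlgebraicGeometry.Motives

namespace Literature.AlgebraicGeometry.AbelianSchemes

namespace AbelianSchemeOver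

variable {T : Scheme.{u}} [IsReduced T] [IsLocallyNoetherian T] (A : AbelianSchemeOver T)
  {Y Y' : Scheme.{u}} {r : A.X.left ⟶ Y} {r' : T ⟶ Y'} {G : Type*} [Group G]
  (ρ : ActionOver r G) (τ : ActionOver r' G)
  (hι : ∀ g : G, τ.autHom g ≫ A.unitSection = A.unitSection ≫ ρ.autHom g)
  {E : A.X.left.Modules}

/-! ## §1 Morphisms `σ_g^* E → E` and linearisations are determined along the unit section -/

/-- **A would-be structure morphism `σ_g^* E → E` of a line bundle on `A` is determined by its restriction along the
(equivariant) unit section** (`T` reduced, locally Noetherian; the comparison morphism an isomorphism): `restrictAlong`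
is `squareIso ≫ ε^*(-)`, and ★ `hom_eq_of_pullback_unitSection_map_eq`. [cite: MumfordAV1970, §8 (pp. 78–80)]
[cite: MumfordFogartyKirwan1994, Ch. 1 §3 Definition 1.6 (p. 30)] -/
theorem hom_eq_of_restrictAlong_unitSection_eq (h₁ : HasRank E 1) (g : G)
    (ψ χ : (Scheme.Modules.pullback (ρ.autHom g)).obj E ⟶ E) [IsIso χ]
    (h : restrictAlong ρ τ A.unitSection hι E g ψ = restrictAlong ρ τ A.unitSection hι E g χ) : ψ = χ := by
  refine hom_eq_of_pullback_unitSection_map_eq (hasRank_pullback _ h₁) ψ χ ?_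
  rw [restrictAlong, restrictAlong] at h
  exact (cancel_epi (squareIso (hι g) E).hom).1 h

/-- **A `G`-linearisation of a line bundle on `A` is determined by its restriction along the unit section.**
[cite: MumfordAV1970, §8 (pp. 78–80)] [cite: MumfordFogartyKirwan1994, Ch. 1 §3 Definition 1.6 (p. 30)] -/
theorem equivariantStructure_iso_eq_of_restrictAlong_eq (h₁ : HasRank E 1) (Φ Φ' : ρ.EquivariantStructure E)
    (h : ∀ g : G, restrictAlong ρ τ A.unitSection hι E g (Φ.iso g).hom =
      restrictAlong ρ τ A.unitSection hι E g (Φ'.iso g).hom) (g : G) : Φ.iso g = Φ'.iso g :=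
  Iso.ext (A.hom_eq_of_restrictAlong_unitSection_eq ρ τ hι h₁ g _ _ (h g))

/-! ## §2 Rescaling: every isomorphism on `T` is the restriction of one on `A` -/

omit [IsReduced T] [IsLocallyNoetherian T] in
/-- `p^♯` followed by `ε^♯` is the identity on `Γ(T, 𝒪)`. [cite: MumfordFogartyKirwan1994, Ch. 6 §1 Definition 6.1 (p. 115)] -/
theorem unitSection_appTop_hom_appTop (a : Γ(T, ⊤)) : A.unitSection.appTop (A.X.hom.appTop a) = a := by
  rw [← CommRingCat.comp_apply A.X.hom.appTop, ← Scheme.Hom.comp_appTop, A.unitSection_comp_hom, Scheme.Hom.id_appTop]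
  rfl

omit [IsReduced T] [IsLocallyNoetherian T] in
/-- **Rescaling by `p^♯ a` restricts to rescaling by `a`**: `R(ψ ≫ (p^♯ a)·) = R(ψ) ≫ (a·)` (★ `restrictAlong_comp`,
★ `pullback_map_globalScalar`, `ε^♯ p^♯ = id`). [cite: MumfordAV1970, §8 (pp. 78–80)] -/
theorem restrictAlong_comp_globalScalar_appTop (g : G) (ψ : (Scheme.Modules.pullback (ρ.autHom g)).obj E ⟶ E)
    (a : Γ(T, ⊤)) :
    restrictAlong ρ τ A.unitSection hι E g (ψ ≫ globalScalar E (A.X.hom.appTop a)) =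
      restrictAlong ρ τ A.unitSection hι E g ψ ≫
        globalScalar ((Scheme.Modules.pullback A.unitSection).obj E) a := by
  rw [restrictAlong_comp, pullback_map_globalScalar, unitSection_appTop_hom_appTop]

omit [IsReduced T] [IsLocallyNoetherian T] in
/-- **Every isomorphism `N : τ_g^* ε^* E ≅ ε^* E` is the restriction along `ε` of an isomorphism `σ_g^* E ≅ E`**, provided
ONE isomorphism `ψ : σ_g^* E ≅ E` exists: `R(ψ)` and `N` differ by a unit `d ∈ Γ(T, 𝒪)ˣ` (★ `exists_unique_eq_globalScalar`
on the rank-one `ε^* E`), and `ψ ≫ (p^♯ d)·` restricts to `N`. [cite: MumfordAV1970, §8 (pp. 78–80)] [cite: MilneAV2008, I §8 p. 40] -/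
theorem exists_iso_restrictAlong_eq (h₁ : HasRank E 1) (g : G) (ψ : (Scheme.Modules.pullback (ρ.autHom g)).obj E ≅ E)
    (N : (Scheme.Modules.pullback (τ.autHom g)).obj ((Scheme.Modules.pullback A.unitSection).obj E) ≅
      (Scheme.Modules.pullback A.unitSection).obj E) :
    ∃ φ : (Scheme.Modules.pullback (ρ.autHom g)).obj E ≅ E, restrictAlong ρ τ A.unitSection hι E g φ.hom = N.hom := by
  have h₁ε : HasRank ((Scheme.Modules.pullback A.unitSection).obj E) 1 := hasRank_pullback _ h₁
  let θ := restrictAlongIso τ A.unitSection hι g ψ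
  -- the two isomorphisms differ by a unit of `Γ(T, 𝒪)`
  obtain ⟨d, hd, -⟩ := exists_unique_eq_globalScalar h₁ε (θ.inv ≫ N.hom)
  obtain ⟨d', hd', -⟩ := exists_unique_eq_globalScalar h₁ε (N.inv ≫ θ.hom)
  have hdd' : d' * d = 1 := by
    refine eq_of_globalScalar_eq Nat.one_pos h₁ε ?_
    rw [globalScalar_mul, ← hd, ← hd', globalScalar_one, Category.assoc, N.hom_inv_id_assoc, θ.inv_hom_id]
  have hd'd : d * d' = 1 := by rw [mul_comm]; exact hdd'
  -- rescale `ψ` by the unit `p^♯ d`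
  let eD : E ≅ E :=
    { hom := globalScalar E (A.X.hom.appTop d)
      inv := globalScalar E (A.X.hom.appTop d')
      hom_inv_id := by rw [← globalScalar_mul, ← map_mul, hdd', map_one, globalScalar_one]
      inv_hom_id := by rw [← globalScalar_mul, ← map_mul, hd'd, map_one, globalScalar_one] }
  refine ⟨ψ ≪≫ eD, ?_⟩
  rw [Iso.trans_hom, A.restrictAlong_comp_globalScalar_appTop ρ τ hι, ← hd, ← restrictAlongIso_hom,
    θ.hom_inv_id_assoc]

/-! ## §3 Rigid descent of a linearisation along the unit section -/

/-- **RIGID DESCENT OF A LINEARISATION ALONG THE UNIT SECTION (reduced base).** Let `p : A → T` be an abelian scheme over a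
reduced locally Noetherian `T`, `ρ` an action of `G` on `A` and `τ` one on `T` making the unit section `ε` equivariant, and `E`
a line bundle on `A` with `σ_g^* E ≅ E` for every `g ∈ G`. Then every `G`-linearisation `Ψ` of `ε^* E` (for `τ`) is the
restriction along `ε` of a `G`-linearisation `Φ` of `E` (for `ρ`) — unique by `equivariantStructure_iso_eq_of_restrictAlong_eq`.
(Each `Φ_g`: §2; unit and cocycle conditions: both sides are isomorphisms with the same restriction along `ε` — ★
`restrictAlong_pullbackOneIso`, ★ `restrictAlong_mul`, `Ψ.iso_one`, `Ψ.iso_mul` — hence equal, §1.)  Mumford's normalisation of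
the `K(L)`-linearisation of `Λ(L)` along `{0} × X`, in families. [cite: MumfordAV1970, §8 (pp. 78–80)]
[cite: MumfordFogartyKirwan1994, Ch. 1 §3 Definition 1.6 (p. 30)] [cite: MilneAV2008, I §8 p. 40] -/
theorem exists_equivariantStructure_of_restrictAlong_unitSection (h₁ : HasRank E 1)
    (hT : ∀ g : G, Nonempty ((Scheme.Modules.pullback (ρ.autHom g)).obj E ≅ E))
    (Ψ : τ.EquivariantStructure ((Scheme.Modules.pullback A.unitSection).obj E)) :
    ∃ Φ : ρ.EquivariantStructure E,
      ∀ g : G, restrictAlong ρ τ A.unitSection hι E g (Φ.iso g).hom = (Ψ.iso g).hom := by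
  have hE : IsFiniteLocallyFree E := HasRank.isFiniteLocallyFree' h₁
  have step : ∀ g : G, ∃ φ : (Scheme.Modules.pullback (ρ.autHom g)).obj E ≅ E,
      restrictAlong ρ τ A.unitSection hι E g φ.hom = (Ψ.iso g).hom := fun g =>
    A.exists_iso_restrictAlong_eq ρ τ hι h₁ g (hT g).some (Ψ.iso g)
  choose φ hφ using step
  refine ⟨{ iso := φ, iso_one := ?_, iso_mul := fun g h => ?_ }, hφ⟩
  · -- unit condition
    refine Iso.ext (A.hom_eq_of_restrictAlong_unitSection_eq ρ τ hι h₁ 1 _ _ ?_)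
    rw [hφ, Ψ.iso_one, restrictAlong_pullbackOneIso ρ τ A.unitSection hι hE]
  · -- cocycle condition
    refine Iso.ext (A.hom_eq_of_restrictAlong_unitSection_eq ρ τ hι h₁ (g * h) _ _ ?_)
    simp only [Iso.trans_hom, Functor.mapIso_hom]
    rw [hφ, Ψ.iso_mul, restrictAlong_mul ρ τ A.unitSection hι hE, hφ, hφ]
    rfl

/-- The same with the UNIQUENESS clause packaged: the lift is unique. [cite: MumfordAV1970, §8 (pp. 78–80)] -/
theorem existsUnique_equivariantStructure_iso_of_restrictAlong_unitSection (h₁ : HasRank E 1)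
    (hT : ∀ g : G, Nonempty ((Scheme.Modules.pullback (ρ.autHom g)).obj E ≅ E))
    (Ψ : τ.EquivariantStructure ((Scheme.Modules.pullback A.unitSection).obj E)) :
    ∃ Φ : ρ.EquivariantStructure E,
      (∀ g : G, restrictAlong ρ τ A.unitSection hι E g (Φ.iso g).hom = (Ψ.iso g).hom) ∧
        ∀ Φ' : ρ.EquivariantStructure E,
          (∀ g : G, restrictAlong ρ τ A.unitSection hι E g (Φ'.iso g).hom = (Ψ.iso g).hom) →
            ∀ g : G, Φ'.iso g = Φ.iso g := by
  obtain ⟨Φ, hΦ⟩ := A.exists_equivariantStructure_of_restrictAlong_unitSection ρ τ hι h₁ hT Ψ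
  exact ⟨Φ, hΦ, fun Φ' hΦ' g =>
    A.equivariantStructure_iso_eq_of_restrictAlong_eq ρ τ hι h₁ Φ' Φ (fun g => (hΦ' g).trans (hΦ g).symm) g⟩

end AbelianSchemeOver

end Literature.AlgebraicGeometry.AbelianSchemes

end
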